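import Summits.CriticalPhenomena.PercolationContinuityZ3.Theorems.Transplant.BoxProdZ2ULevels
import Summits.CriticalPhenomena.PercolationContinuityZ3.Theorems.Transplant.KNCells2ChainSchedCells
import Summits.CriticalPhenomena.PercolationContinuityZ3.Theorems.Transplant.KNLevelsTargetChain
import HarnessLib

/-!
# The corridor chain of `X □ ℤ²` as TARGET STEPS in the `U`-restricted graph (packaging for p3-g2's kits; EDGE-CONTACTS.md §7): step `i ≤ 86`
# has the `U`-levels `U ∩ (W × (core_i)⟨j⟩)` over the constant planar schedule (`ChainPlanar.Sched`), the region `D_i = U ∩ (W × region_i)`, the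
# target `T_i = U ∩ (W × core_{i+1}) = X^{(i+1)}_0` (linked by construction); `U = E_i ∪ E^α_{v,x} ∪ H^β_{x,y}` is the corridor region of the
# history, so the fibre cross-section of a row is its fresh fibre range and every contact is macro (design HOME/prim-bschramm-p2-g2/F8-DESIGN.md §9,
# EDGE-CONTACTS.md §7; supersedes the fibre-growing packaging `KNCellsBoxProdZ2Chain`, whose design (B) was refuted by p3-g2's RETRACTION.md)

builds on p205010 (kernel theorem, internal audit signed; external expert review pending) — nothing in this file uses p205010.
Lane `prim-bschramm`, seat `prim-bschramm-p2` (Corridor-over-levels; drafted at p3-g2's request 12:04Z); helper file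
(`--supports stmt-CriticalPhenomena-4575`).

* `uSlice U S = U ∩ (W × S)`; `ChainUData` (U, cells C, x, du, t, R', Rlev, N, j₀, j₁, root, Sfin); `lo i / hi i`, `stepL i = uLData …`, `stepD i`,
  `stepT i`, `step i : KNLevels.TStep (restrictGraph (X □ zdGraph 2) U)`;
* `stepL_X`, **`stepT_eq_X_zero`**, **`encl`** (`X^{(i)}_{Rlev+1} ⊆ D_i` when `Rlev + 1 ≤ R'`), `stepT_subset_stepD`, `stepT_nonempty` (given the
  anchor fibre over the planar cells), `stepD_subset` (`⊆ U ∩ (W × (Q_x ∪ H_{x,y}))`), `cube_subset_X_zero`, `stepT_last_subset`;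
* **`kitsAt_step`** — `KitsAt` from a subbox region (`isSubbox_Wcor_graph`), finite support, `root ∉ D_i`, the count inequality and the per-level
  kit clause (p3-g2: macro contacts, window = the row's cross-section, deep retraction; planar ROOM = `ChainPlanar.Sched.core_route`).
[cite: KozmaNitzan2024, §4 Lemma 10 (p. 17), Lemma 11 (p. 22), Lemma 12 (pp. 23–25), p. 30]
-/

noncomputable section

open MeasureTheory ProbabilityTheory
open scoped ENNReal

namespace Summit.CriticalPhenomena.PercolationContinuityZ3.Theorems

namespace Transplant

namespace BoxProdZ2

open Literature.Probability.Percolation Literature.Probability.LatticeModels SimpleGraph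
open Literature.Probability.Percolation.KozmaNitzan
open Literature.Probability.Percolation.KozmaNitzan.Cells (sgOf sgOf_sign)
open KNLevels ChainPlanar

variable {W : Type*} [DecidableEq W] (X : SimpleGraph W) [X.LocallyFinite]

omit [DecidableEq W] [X.LocallyFinite] in
/-- The part of `U` over a planar set: `U ∩ (W × S)`. [folklore] -/
def uSlice (U : Finset (W × Site 2)) (S : Finset (Site 2)) : Finset (W × Site 2) := U.filter fun v => v.2 ∈ S

omit [DecidableEq W] [X.LocallyFinite] in
/-- Membership in a slice. [folklore] -/
theorem mem_uSlice_iff {U : Finset (W × Site 2)} {S : Finset (Site 2)} {v : W × Site 2} : v ∈ uSlice U S ↔ v ∈ U ∧ v.2 ∈ S :=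
  Finset.mem_filter

omit [DecidableEq W] [X.LocallyFinite] in
/-- Slices are monotone in the planar set. [folklore] -/
theorem uSlice_mono (U : Finset (W × Site 2)) {S S' : Finset (Site 2)} (h : S ⊆ S') : uSlice U S ⊆ uSlice U S' := fun v hv => by
  rw [mem_uSlice_iff] at hv ⊢; exact ⟨hv.1, h hv.2⟩

omit [DecidableEq W] [X.LocallyFinite] in
/-- A `U`-level is a slice. [folklore] -/
theorem uLevel_eq_uSlice (U : Finset (W × Site 2)) (lo hi : Site 2) (j : ℕ) :
    uLevel U lo hi j = uSlice U (Finset.Icc (lo - (j : Site 2)) (hi + (j : Site 2))) := rfl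

/-- **The data of a corridor chain** in the `U`-restricted graph of `X □ ℤ²`. [cite: KozmaNitzan2024, §4 Lemma 12 (pp. 23–25)] -/
structure ChainUData (W : Type*) where
  /-- the corridor region `U` of the history -/
  U : Finset (W × Site 2)
  /-- the planar cells -/
  C : PCells
  /-- the examined macro-vertex `x` -/
  x : Site 2
  /-- the onward direction -/
  du : MDir
  /-- the planar unit `t = r / 4` -/
  t : ℕ
  /-- the planar neighbourhood radius `R' ≥ Rlev + 1` -/
  R' : ℕ
  /-- the level depth of every step -/
  Rlev : ℕ
  /-- the number of contacts demanded by Step II -/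
  N : ℕ
  /-- the level window -/
  j₀ : ℕ
  /-- the level window -/
  j₁ : ℕ
  /-- the source -/
  root : W × Site 2
  /-- the finite support of the weighting -/
  Sfin : Finset (W × Site 2)

namespace ChainUData

variable {X} (P : ChainUData W)

/-- Lower corner of core `i`. [folklore] -/
def lo (i : ℕ) : Site 2 :=
  sLo P.du.1 (sgOf P.du) (P.C.cen P.x) (Sched.coreα P.t P.R' i) (Sched.coreβ P.t P.R' i) (Sched.coreW P.t P.R' i)

/-- Upper corner of core `i`. [folklore] -/
def hi (i : ℕ) : Site 2 :=
  sHi P.du.1 (sgOf P.du) (P.C.cen P.x) (Sched.coreα P.t P.R' i) (Sched.coreβ P.t P.R' i) (Sched.coreW P.t P.R' i)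

/-- The planar core `i` (as the signed box of the schedule). [folklore] -/
def pcore (i : ℕ) : Finset (Site 2) := Sched.core P.t P.R' P.du.1 (sgOf P.du) (P.C.cen P.x) i

/-- The planar region `i`. [folklore] -/
def pregion (i : ℕ) : Finset (Site 2) := Sched.region P.t P.R' P.du.1 (sgOf P.du) (P.C.cen P.x) i

variable (X)

/-- **The level data of step `i`** (`U`-levels in `G'_U`). [cite: KozmaNitzan2024, §4 Lemma 10 (p. 17)] -/
def stepL (i : ℕ) : LData (restrictGraph (X □ zdGraph 2) P.U) := uLData X P.U (P.lo i) (P.hi i) P.root P.Sfin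

/-- **The region of step `i`**: `U ∩ (W × region_i)`. [cite: KozmaNitzan2024, §4 Lemma 10 (p. 17: D)] -/
def stepD (i : ℕ) : Finset (W × Site 2) := uSlice P.U (P.pregion i)

/-- **The target of step `i`**: `U ∩ (W × core_{i+1})`. [cite: KozmaNitzan2024, §4 Lemma 10 (p. 17: T)] -/
def stepT (i : ℕ) : Finset (W × Site 2) := uSlice P.U (P.pcore (i + 1))

/-- **Step `i` as a target step.** [cite: KozmaNitzan2024, §4 Lemma 12 (pp. 23–25)] -/
def step (i : ℕ) : TStep (restrictGraph (X □ zdGraph 2) P.U) := ⟨P.stepL X i, P.stepD i, P.stepT i, P.Rlev, P.N, P.j₀, P.j₁⟩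

/-! ## The levels, the link, the containments -/

omit [DecidableEq W] in
/-- The planar core is the order interval of its corners. [folklore] -/
theorem Icc_lo_hi (i : ℕ) : Finset.Icc (P.lo i) (P.hi i) = P.pcore i := rfl

omit [DecidableEq W] [X.LocallyFinite] in
/-- **The levels of step `i`**: `U ∩ (W × sBox(coreα i - j, coreβ i + j, coreW i + j))`. [cite: KozmaNitzan2024, §4 p. 15 (B⟨j⟩)] -/
theorem stepL_X (i j : ℕ) : (P.stepL X i).X j =
    uSlice P.U (sBox P.du.1 (sgOf P.du) (P.C.cen P.x) (Sched.coreα P.t P.R' i - j) (Sched.coreβ P.t P.R' i + j) (Sched.coreW P.t P.R' i + j)) := by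
  rw [stepL, uLData_X, uLevel_eq_uSlice, lo, hi, sBox_enlarge _ _ (sgOf_sign P.du)]

omit [DecidableEq W] [X.LocallyFinite] in
/-- The first level of step `i` is `U ∩ (W × core_i)`. [folklore] -/
theorem stepL_X_zero (i : ℕ) : (P.stepL X i).X 0 = uSlice P.U (P.pcore i) := by
  rw [stepL_X]; push_cast; simp only [sub_zero, add_zero]; rfl

omit [DecidableEq W] [X.LocallyFinite] in
/-- **The chain is linked by construction**: `T_i = X^{(i+1)}_0`. [cite: KozmaNitzan2024, §4 Lemma 12] -/
theorem stepT_eq_X_zero (i : ℕ) : P.stepT i = (P.stepL X (i + 1)).X 0 := by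
  rw [stepL_X_zero, stepT]

omit [DecidableEq W] [X.LocallyFinite] in
/-- The sources agree. [folklore] -/
theorem step_o (i : ℕ) : (P.step X i).L.o = P.root := rfl

variable {P}

omit [DecidableEq W] [X.LocallyFinite] in
/-- **`X^{(i)}_{Rlev+1} ⊆ D_i`** when `Rlev + 1 ≤ R'`. [cite: KozmaNitzan2024, §4 Lemma 10 (p. 17: B⟨R+1⟩ ⊆ D)] -/
theorem encl (hR : 100 * P.R' ≤ P.t) (hRl : P.Rlev + 1 ≤ P.R') {i : ℕ} (hi : i ≤ Sched.nLast) :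
    (P.stepL X i).X (P.Rlev + 1) ⊆ P.stepD i := by
  rw [stepL_X, stepD]
  refine uSlice_mono P.U ((sBox_mono (sgOf_sign P.du) _ ?_ ?_ ?_).trans (Sched.enlarge_core_subset_region (sgOf_sign P.du) _ hR hi)) <;>
    push_cast <;> omega

omit [DecidableEq W] in
/-- **`T_i ⊆ D_i`.** [folklore] -/
theorem stepT_subset_stepD (hR : 100 * P.R' ≤ P.t) {i : ℕ} (hi : i ≤ Sched.nLast) : P.stepT i ⊆ P.stepD i :=
  uSlice_mono P.U (Sched.core_succ_subset_region (sgOf_sign P.du) _ hR hi)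

omit [DecidableEq W] in
/-- **`T_i` is nonempty** as soon as some fibre `β` lies in `U` over every point of `Q_x ∪ H_{x,y}` (`r = 4t`). [folklore] -/
theorem stepT_nonempty (hr : P.C.r = 4 * P.t) (hR : 100 * P.R' ≤ P.t) {β : W} (hβ : ∀ s ∈ P.C.Q P.x ∪ P.C.Hfull P.x P.du, (β, s) ∈ P.U)
    {i : ℕ} (hi : i ≤ Sched.nLast) : (P.stepT i).Nonempty := by
  obtain ⟨s, hs⟩ := Sched.core_nonempty (sgOf_sign P.du) (P.C.cen P.x) hR (by omega : i + 1 ≤ Sched.nLast + 1) (t := P.t) (R' := P.R') (a := P.du.1)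
  refine ⟨(β, s), (mem_uSlice_iff).2 ⟨hβ s ?_, hs⟩⟩
  exact Sched.region_subset_Q_union_Hfull hr hR hi (Sched.core_succ_subset_region (sgOf_sign P.du) _ hR hi hs)

omit [DecidableEq W] in
/-- **`D_i ⊆ U ∩ (W × (Q_x ∪ H_{x,y}))`** (`r = 4t`). [cite: KozmaNitzan2024, §4 p. 30 (E_{v,x} ∪ H_{x,y})] -/
theorem stepD_subset (hr : P.C.r = 4 * P.t) (hR : 100 * P.R' ≤ P.t) {i : ℕ} (hi : i ≤ Sched.nLast) :
    P.stepD i ⊆ uSlice P.U (P.C.Q P.x ∪ P.C.Hfull P.x P.du) :=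
  uSlice_mono P.U (Sched.region_subset_Q_union_Hfull hr hR hi)

omit [DecidableEq W] in
/-- **The arrival cube lies in the first core**: `B_X(α, R_M) × M_x ⊆ X^{(0)}_0` as soon as it lies in `U`. [cite: KozmaNitzan2024, §4 p. 28 ((32): M_v)] -/
theorem cube_subset_X_zero (hr : P.C.r = 4 * P.t) (hR : 100 * P.R' ≤ P.t) {α : W} {RM : ℕ} (hα : ballFin X α RM ×ˢ P.C.M P.x ⊆ P.U) :
    ballFin X α RM ×ˢ P.C.M P.x ⊆ (P.stepL X 0).X 0 := by
  rw [stepL_X_zero]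
  intro v hv
  refine (mem_uSlice_iff).2 ⟨hα hv, ?_⟩
  rw [pcore, Sched.core_zero_eq_M hr hR]
  exact (Finset.mem_product.1 hv).2

omit [DecidableEq W] in
/-- **The last target lies in `U ∩ (W × (M_y ∩ H_{x,y}))`.** [cite: KozmaNitzan2024, §4 p. 26 (M_x, H_{v,x})] -/
theorem stepT_last_subset (hr : P.C.r = 4 * P.t) (hR : 100 * P.R' ≤ P.t) :
    P.stepT Sched.nLast ⊆ uSlice P.U (P.C.M (P.x + stepVec P.du) ∩ P.C.Hfull P.x P.du) :=
  uSlice_mono P.U (Finset.subset_inter (Sched.core_last_subset_M hr hR) (Sched.core_last_subset_Hfull hr hR))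

/-! ## The kits -/

/-- **`KitsAt` of step `i`** from a subbox region, finite support, the source off the region, the count inequality and the per-level kit
clause. [cite: KozmaNitzan2024, §4 Lemma 10 (p. 17)] -/
theorem kitsAt_step (hr : P.C.r = 4 * P.t) (hR : 100 * P.R' ≤ P.t) (hRl : P.Rlev + 1 ≤ P.R') {β : W}
    (hβ : ∀ s ∈ P.C.Q P.x ∪ P.C.Hfull P.x P.du, (β, s) ∈ P.U) {i : ℕ} (hi : i ≤ Sched.nLast)
    {Wt : Sym2 (W × Site 2) → unitInterval} {p : unitInterval} {Δ : ℕ} {δ : ℝ}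
    (hsub : KNLevels.IsSubbox (restrictGraph (X □ zdGraph 2) P.U) Wt p (P.stepD i)) (hfin : FinSupp Wt P.Sfin) (hDS : P.stepD i ⊆ P.Sfin)
    (ho : P.root ∉ P.stepD i) (hoS : P.root ∈ P.Sfin) (hj : P.j₁ ≤ P.Rlev)
    (hcount : 1 / (1 - (p : ℝ)) ^ (Δ * P.N) ≤ δ * ((Finset.Icc P.j₀ P.j₁).card : ℝ))
    (hkits : ∀ j ∈ Finset.Icc P.j₀ P.j₁, ∃ (σ : SData (W × Site 2)) (S : Finset (W × Site 2)), SHyp (P.stepL X i) j σ ∧ σ.N ≤ P.N ∧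
      (1 - (p : ℝ) ^ σ.sB) ^ σ.k ≤ δ ∧ S ⊆ (P.stepL X i).X j ∧ S ⊆ P.stepD i ∧
      (∀ x ∈ σ.K, ∀ e ∈ σ.seed x, e ∉ wireSet (↑S : Set (W × Site 2))) ∧ (∀ x ∈ σ.K, σ.face x ⊆ S) ∧
      (∀ x ∈ σ.K, 1 - 3 * δ ≤ (prodBernoulli Wt).real {ω | ∃ u ∈ σ.face x,
        1 - δ < (prodBernoulli (pinW Wt (wireSet (↑S : Set (W × Site 2))) ω)).real
          (⋃ t ∈ P.stepT i, openConnIn (↑(P.stepD i) : Set (W × Site 2)) u t)})) :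
    (P.step X i).KitsAt Wt p Δ δ :=
  ⟨lhyp_U X P.U (P.lo i) (P.hi i) hsub hfin hDS (encl X hR hRl hi) ho hoS, hj,
    stepT_subset_stepD hR hi, stepT_nonempty hr hR hβ hi, hcount, hkits⟩

end ChainUData

end BoxProdZ2

end Transplant

end Summit.CriticalPhenomena.PercolationContinuityZ3.Theorems

end
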